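import Summits.BirchSwinnertonDyer.BirchSwinnertonDyer.Theorems.ResidualThetaTransportAtTwoResidualSignedLambdaLowerCMAtTwoDeepHalfAwayTwoCharacterReadback
import Summits.BirchSwinnertonDyer.BirchSwinnertonDyer.Theorems.ResidualThetaTransportAtTwoResidualSignedLambdaLowerCMAtTwoAwayExhaustion
import Summits.BirchSwinnertonDyer.BirchSwinnertonDyer.Theorems.ResidualThetaTransportAtTwoResidualSignedLambdaLowerCMAtTwoRhoLayerPairingConj
import HarnessLib

/-!
# S4₀'s S₀-PIN TRANSFER: a class `x ∈ 𝐇¹_Γ(T_ρ)` whose reductions have the PRESCRIBED local classes `t n k w` built from `χ : PAway`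
# (currency (α), the output of p697362) satisfies `locdS x = χ` for every S₀-side functional `locdS` carrying the frame's value pin

Route `ResidualThetaTransportAtTwo` (RTT), crux RSL_g `ResidualSignedLambdaLowerCMAtTwo` (stmt-BirchSwinnertonDyer-22608); seat
`prover-bsd-wall-tp2-p2x` g19 (`--supports 22608 --as helper`, closes nothing). THEOREMS ONLY (no definition, no named fact, no instance,
no notation, no `sorry`). BSD is not proved by any of this; RSL_g is not proved here.

WHY (STUB-PLAN rev 22 S96: «the (α) ↔ (β) reading is OWNED by the S4₀ S₀-pin transfer»). The S4₀ text concludes `∃ a ≠ 0, ∃ x, a • χ = πₐ.locdS x`.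
The socket `DeepHalfAssemblyAway.exists_iwasawaH1_prescribed_of_levelwise_orthogonal` (p697362) delivers `x ∈ I.H` with
`loc_w(Sh_n(red_{2^k}(proj_n x))) = t n k w` for `n ≥ N₀` (currency (α)); `AwayCharacterReadback.exists_local_of_characters` (p701888) built `t n k w`
from `χ` with Mackey components `H¹(Φ_{c.out Γ_n}) (t n k w) = Sh(b n k w c)`, `χ w c ∘ j_{n,k} = (⟨b n k w c, ·⟩).val • 2^{-k}`; the frame's VALUE PIN
(`AwayPins.hlocdS`, currency (β)) reads `locdS x w c` on `j_{m,k} y` as `(⟨red(conj_{c.out} proj_m x), y⟩_{m,2^k,w}).val • 2^{-k}`. This file closes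
the triangle WITH `a = 1`:

* **`layerLocOf_conjMap_reduce_eq_of_prescribed`** — from the (α) identity at `(n, k, w)` and the Mackey components: 
  `loc_n(c.out · red_{2^k}(proj_n x)) = b n k w c` (`cohomologyMap_resCoindFinHomR_localization_shapiroLift` + `shapiroLift_injective`).
* **`locdS_eq_of_prescribed`** — hence `locdS x = χ` in `PAway`: on `j_{m,k} y'` (`m ≥ max N₀ n_w`) both sides are the same layer pairing
  (`reduceH1CofreePkTorsion_conjMap`, `layerPairingOf_apply`), and the `j`-images exhaust `D_w` (w2's p700479 `exists_jAway_eq_of_le`).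
  The pin is taken as HYPOTHESES (`locdS`, `hlocdS` = the two `AwayPins` fields verbatim with `π.ePk ↦ ePk`), so the lemma is pin-bundle-free.

References: [PerrinRiou1994Invent] §3.6.1; [Kato2004Asterisque] §13.8 (pp. 228–229); [GreenbergVatsal2000] §2 Prop. 2.4; [NeukirchSchmidtWingberg2008]
I §5 (1.5.6)–(1.5.7), I §6 (1.6.4); [SerreGaloisCohomology1997] I §2.2 Prop. 8.
-/

set_option autoImplicit false
-- the Theorems namespace of this sub repeats the summit name by design (D-0017 nested layout)
set_option linter.dupNamespace false

noncomputable section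

open scoped Classical

namespace Summit.BirchSwinnertonDyer.BirchSwinnertonDyer.Theorems

namespace ThetaTransport.AwayTransfer

open CategoryTheory Function Field NumberField IsDedekindDomain
  Literature.NumberTheory.EllipticCurves Literature.NumberTheory.EllipticCurves.CyclotomicLayer
  Literature.NumberTheory.EllipticCurves.GreenbergSelmer
  Literature.NumberTheory.GaloisRepresentations Literature.NumberTheory.GaloisRepresentations.DiscreteGaloisModule
  Literature.NumberTheory.GaloisCohomology Literature.NumberTheory.EllipticCurves.Kato2004 ZpExtension
  Summit.BirchSwinnertonDyer.BirchSwinnertonDyer.Theorems.OnePair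
open ThetaTransport.LayerPairingMackeyDual ThetaTransport.ProfiniteExhaustion

variable (S : Set (PadicAlgCl 2)) (ρ : FramedGaloisRep ℚ ↥(padicCoeffIntegers S) 2)
  (ePk : ∀ k : ℕ, ↥(AddSubgroup.torsionBy (Cofree ρ ↥(padicCoeffField S)) ((2 ^ k : ℕ) : ℤ)) →
    ↥(AddSubgroup.torsionBy (Cofree ρ ↥(padicCoeffField S)) ((2 ^ k : ℕ) : ℤ)) → AlgebraicClosure ℚ)
  (hμPk : ∀ k a b, ePk k a b ^ (2 ^ k) = 1)
  (hadd₁Pk : ∀ k a₁ a₂ b, ePk k (a₁ + a₂) b = ePk k a₁ b * ePk k a₂ b)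
  (hadd₂Pk : ∀ k a b₁ b₂, ePk k a (b₁ + b₂) = ePk k a b₁ * ePk k a b₂)
  (hgalPk : ∀ k (σ : absoluteGaloisGroup ℚ) (a b : ↥(AddSubgroup.torsionBy (Cofree ρ ↥(padicCoeffField S)) ((2 ^ k : ℕ) : ℤ))),
    σ • ePk k a b = ePk k (cofreeTorsionGaloisModule S ρ _ σ a) (cofreeTorsionGaloisModule S ρ _ σ b))
  (κ : ZpExtension ℚ 2) (S₀ : Finset (HeightOneSpectrum (𝓞 ℚ))) {γ : absoluteGaloisGroup ℚ}
  (I : IwasawaH1DataCoeff (FramedGaloisRep.toGaloisRep ρ) 2 κ γ) (x : I.H)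
  [instF : ∀ n : ℕ, Fintype (absoluteGaloisGroup ℚ ⧸ κ.layerSubgroup n)]
  (N₀ : ℕ)
  (b : ∀ (n k : ℕ) (w : ↥S₀), Cosets κ (w : HeightOneSpectrum (𝓞 ℚ)) → Dlev S κ ρ w n k)
  (t : ∀ (n k : ℕ) (w : ↥S₀), galoisCohomology
    (((cofreeTorsionGaloisModule S ρ ((2 ^ k : ℕ) : ℤ)).coind (κ.layerSubgroup n) (κ.isOpen_layerSubgroup n)).toLocal
      (Sum.inr (w : HeightOneSpectrum (𝓞 ℚ)))) 1)
  (hu : ∀ n, N₀ ≤ n → ∀ (k : ℕ) (w : ↥S₀) (c : Cosets κ (w : HeightOneSpectrum (𝓞 ℚ))),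
    cohomologyMap (resCoindFinHomR (cofreeTorsionGaloisModule S ρ ((2 ^ k : ℕ) : ℤ)).toTopRep (κ.layerSubgroup n)
        (resGalOfEmb (closureEmb (K := ℚ) ((w : HeightOneSpectrum (𝓞 ℚ)).adicCompletion ℚ))) (c.out : absoluteGaloisGroup ℚ ⧸ κ.layerSubgroup n)) 1
        (t n k w) =
      layerShapiroOf (cofreeTorsionGaloisModule S ρ ((2 ^ k : ℕ) : ℤ)) κ w n (b n k w c))
  (hx : ∀ n k, N₀ ≤ n →
    ∀ {s : absoluteGaloisGroup ℚ ⧸ κ.layerSubgroup n → absoluteGaloisGroup ℚ}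
      (hs : ∀ x : absoluteGaloisGroup ℚ ⧸ κ.layerSubgroup n, (s x : absoluteGaloisGroup ℚ ⧸ κ.layerSubgroup n) = x)
      (hs1 : s ((1 : absoluteGaloisGroup ℚ) : absoluteGaloisGroup ℚ ⧸ κ.layerSubgroup n) = 1),
      ∀ w : ↥S₀,
        galoisCohomology.localization
            ((cofreeTorsionGaloisModule S ρ ((2 ^ k : ℕ) : ℤ)).coind (κ.layerSubgroup n) (κ.isOpen_layerSubgroup n))
            (Sum.inr (w : HeightOneSpectrum (𝓞 ℚ))) 1
            (shapiroLift (cofreeTorsionGaloisModule S ρ ((2 ^ k : ℕ) : ℤ)).toTopRep (κ.layerSubgroup n) (κ.isOpen_layerSubgroup n)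
              hs hs1 (reduceH1CofreePkTorsion S ρ k (κ.layerSubgroup n) (I.proj n x) :
                H1 (cofreeTorsionGaloisModule S ρ ((2 ^ k : ℕ) : ℤ)) (κ.layerSubgroup n))) = t n k w)

include hu hx in
/-- **The (α) identity + the Mackey components pin the conjugated layer localisations of `x`**: for `n ≥ N₀`,
`loc_n(c.out · red_{2^k}(proj_n x)) = b n k w c` at `w ∈ S₀` — apply `H¹(Φ_{c.out Γ_n})` to `loc_w(Sh(red proj x)) = t n k w`, read the left side
by `cohomologyMap_resCoindFinHomR_localization_shapiroLift` and the right side by the components, then cancel the (injective) Shapiro lift.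
[cite: NeukirchSchmidtWingberg2008, I §5 (1.5.6)–(1.5.7), I §6 (1.6.4)] [cite: Kato2004Asterisque, §13.8 (p. 228)] -/
theorem layerLocOf_conjMap_reduce_eq_of_prescribed {n : ℕ} (hn : N₀ ≤ n) (k : ℕ) (w : ↥S₀)
    (c : Cosets κ (w : HeightOneSpectrum (𝓞 ℚ))) :
    layerLocOf (cofreeTorsionGaloisModule S ρ ((2 ^ k : ℕ) : ℤ)) κ w n
        (conjMap (cofreeTorsionGaloisModule S ρ ((2 ^ k : ℕ) : ℤ)).toTopRep (κ.layerSubgroup n) c.out 1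
          (reduceH1CofreePkTorsion S ρ k (κ.layerSubgroup n) (I.proj n x) :
            H1 (cofreeTorsionGaloisModule S ρ ((2 ^ k : ℕ) : ℤ)) (κ.layerSubgroup n))) = b n k w c := by
  obtain ⟨s, hs, hs1⟩ := exists_reps_one (κ.layerSubgroup n)
  have h1 := cohomologyMap_resCoindFinHomR_localization_shapiroLift (cofreeTorsionGaloisModule S ρ ((2 ^ k : ℕ) : ℤ)) κ
    (w : HeightOneSpectrum (𝓞 ℚ)) n hs hs1 c.out
    (reduceH1CofreePkTorsion S ρ k (κ.layerSubgroup n) (I.proj n x) : H1 (cofreeTorsionGaloisModule S ρ ((2 ^ k : ℕ) : ℤ)) (κ.layerSubgroup n))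
  rw [hx n k hn hs hs1 w, hu n hn k w c] at h1
  unfold layerShapiroOf at h1
  exact (shapiroLift_injective (localRepOf (cofreeTorsionGaloisModule S ρ ((2 ^ k : ℕ) : ℤ)) (w : HeightOneSpectrum (𝓞 ℚ)))
    (layerGroup κ (w : HeightOneSpectrum (𝓞 ℚ)) n) (isOpen_layerGroup κ (w : HeightOneSpectrum (𝓞 ℚ)) n)
    (layerReps_spec κ (w : HeightOneSpectrum (𝓞 ℚ)) n) (layerReps_one κ (w : HeightOneSpectrum (𝓞 ℚ)) n) h1).symm

variable (χ : PAway S κ ρ S₀)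
  (hb : ∀ n, N₀ ≤ n → ∀ (k : ℕ) (w : ↥S₀) (c : Cosets κ (w : HeightOneSpectrum (𝓞 ℚ))) (y : Dlev S κ ρ w n k),
    χ w c (jAway S κ ρ w n k y) =
      (layerPairingH1Of (cofreeTorsionGaloisModule S ρ ((2 ^ k : ℕ) : ℤ)) (2 ^ k) (ePk k) (hμPk k) (hadd₁Pk k) (hadd₂Pk k) (hgalPk k)
          κ w n (b n k w c) y).val • ((((2 : ℚ) ^ k)⁻¹ : ℚ) : AddCircle (1 : ℚ)))
  (locdS : I.H →+ PAway S κ ρ S₀)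
  (hlocdS : ∀ (w : ↥S₀) (c : Cosets κ (w : HeightOneSpectrum (𝓞 ℚ))) (m : ℕ), nfl (w : HeightOneSpectrum (𝓞 ℚ)) ≤ m →
    ∀ (k : ℕ) (x : I.H) (y : Dlev S κ ρ w m k),
    locdS x w c (jAway S κ ρ w m k y) =
      (layerPairingOf (cofreeTorsionGaloisModule S ρ ((2 ^ k : ℕ) : ℤ)) (2 ^ k) (ePk k) (hμPk k) (hadd₁Pk k) (hadd₂Pk k) (hgalPk k) κ w m
        (reduceH1CofreePkTorsion S ρ k (κ.layerSubgroup m)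
          (conjMap (FramedGaloisRep.toGaloisRep ρ).toTopRep (κ.layerSubgroup m) c.out 1 (I.proj m x))) y).val •
        ((((2 : ℚ) ^ k)⁻¹ : ℚ) : AddCircle (1 : ℚ)))

include hu hx hb hlocdS in
set_option maxHeartbeats 1600000 in
-- the pin's `ρ`-coefficient layer-pairing terms make `whnf` during the rewrites expensive
/-- **The S₀-pin transfer with `a = 1`: `locdS x = χ`.** For `w ∈ S₀`, `c ∈ Cosets κ w` and `y ∈ D_w`, write `y = j_{m,k} y'` with
`m ≥ max N₀ n_w` (exhaustion, p700479); then `locdS x w c y = (⟨red(conj_{c.out} proj_m x), y'⟩).val • 2^{-k}` (the value pin),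
`red ∘ conj = conj ∘ red` (`reduceH1CofreePkTorsion_conjMap`), `⟨a, y'⟩ = ⟨loc_m a, y'⟩` (`layerPairingOf_apply`), `loc_m(conj red proj x) = b m k w c`
(`layerLocOf_conjMap_reduce_eq_of_prescribed`), and `(⟨b m k w c, y'⟩).val • 2^{-k} = χ w c y`. [cite: PerrinRiou1994Invent, §3.6.1]
[cite: Kato2004Asterisque, §13.8 (pp. 228–229)] [cite: GreenbergVatsal2000, §2 Prop. 2.4] [cite: SerreGaloisCohomology1997, I §2.2 Prop. 8] -/
theorem locdS_eq_of_prescribed : locdS x = χ := by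
  funext w c
  refine DFunLike.ext _ _ fun y ↦ ?_
  obtain ⟨m, hm, k, y', rfl⟩ := exists_jAway_eq_of_le S κ ρ (w : HeightOneSpectrum (𝓞 ℚ)) (max N₀ (nfl (w : HeightOneSpectrum (𝓞 ℚ)))) y
  have hmN : N₀ ≤ m := le_of_max_le_left hm
  have hmf : nfl (w : HeightOneSpectrum (𝓞 ℚ)) ≤ m := le_of_max_le_right hm
  rw [hlocdS w c m hmf k x y', hb m hmN k w c y', layerPairingOf_apply, reduceH1CofreePkTorsion_conjMap,
    layerLocOf_conjMap_reduce_eq_of_prescribed S ρ κ S₀ I x N₀ b t hu hx hmN k w c]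

end ThetaTransport.AwayTransfer

end Summit.BirchSwinnertonDyer.BirchSwinnertonDyer.Theorems

end
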